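import Literature.NumberTheory.GaloisRepresentations.HomDualRestrictField
import Literature.NumberTheory.GaloisRepresentations.CompletionCompositumEmbedding
import HarnessLib

/-!
# Dictionary: the local layer `K_v(ι L)` of the presentation road IS the cell's compositum `K_v(E)`, hence is
# `K_v`-isomorphic to the completion `L_{w_v}` at the distinguished place

Topic `NumberTheory/GaloisRepresentations`; namespace `Literature.NumberTheory.GaloisRepresentations.HomDual`.
Theorems only; no definition, no instance, no named fact, no `sorry`.  A two-line bridge between door-c6's
`HomDual.localLayer K K' L` (`HomDualRestrictField`, the field in which the values of the readout maps lie: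
`HomDualLocalData.unitsVal_mem_localLayer`) and door-c5/door-c6's `SemiLocal.compositum ιE v`
(`CompletionCompositumEmbedding`: `compositumEquivEmb : K_v(E) ≃ₐ[K_v] E_{w_v}`, `placeEmb : E_{w_v} → K̄_v`), for the
finite places `K' = K_v = v.adicCompletion K` and `E = ↥L`, `ιE = L.val`:

* `localLayer_eq_compositum` — `localLayer K K_v L = SemiLocal.compositum L.val v` (definitional up to unfolding the
  coercion of `AlgHom.comp`);
* `exists_placeEmb_eq_of_mem_localLayer` — every element of the local layer is `placeEmb v L.val y` for a unique
  `y ∈ L_{w_v}` (the idèle ASSEMBLY reads the `w_v`-component of the sought idèle off the readout map through this).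

HONEST FRAMING: bookkeeping only; no case of Poitou–Tate or BSD is proved here.

## References
* J. W. S. Cassels, A. Fröhlich (eds.), *Algebraic Number Theory* (1967), Ch. II §10 (`L_w = K_v L`). [CasselsFrohlichANT1967]
* J. Neukirch, *Algebraic Number Theory* (1999), Ch. II (8.1)–(8.3). [NeukirchANT1999]
-/

noncomputable section

namespace Literature.NumberTheory.GaloisRepresentations

namespace HomDual

open NumberField IsDedekindDomain Field SemiLocal

variable {K : Type} [Field K] [NumberField K] (v : HeightOneSpectrum (𝓞 K))
variable (L : IntermediateField K (AlgebraicClosure K)) [NumberField L] [IsGalois K L]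

omit [NumberField L] [IsGalois K L] in
/-- **`localLayer K K_v L = K_v(ι L)` is the cell's compositum `SemiLocal.compositum L.val v`.**
[cite: CasselsFrohlichANT1967, Ch. II §10] -/
theorem localLayer_eq_compositum :
    localLayer K (v.adicCompletion K) L = compositum (IntermediateField.val L) v := by
  change IntermediateField.adjoin _ _ = IntermediateField.adjoin _ _
  congr 1

omit [NumberField L] [IsGalois K L] in
/-- Membership transfer along `localLayer_eq_compositum`. [cite: CasselsFrohlichANT1967, Ch. II §10] -/
theorem mem_compositum_of_mem_localLayer {a : AlgebraicClosure (v.adicCompletion K)}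
    (ha : a ∈ localLayer K (v.adicCompletion K) L) : a ∈ compositum (IntermediateField.val L) v := by
  rwa [localLayer_eq_compositum v L] at ha

/-- **Every element of the local layer is the image of a unique element of the completion `L_{w_v}` at the
distinguished place `w_v = embPlace v L.val`** under `placeEmb : L_{w_v} → K̄_v` (`= θ⁻¹`, `compositumEquivEmb`).
[cite: CasselsFrohlichANT1967, Ch. II §10][cite: NeukirchANT1999, Ch. II (8.1)] -/
theorem exists_placeEmb_eq_of_mem_localLayer {a : AlgebraicClosure (v.adicCompletion K)}
    (ha : a ∈ localLayer K (v.adicCompletion K) L) :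
    ∃! y : ((embPlace v (IntermediateField.val L) : HeightOneSpectrum (𝓞 L)).adicCompletion L),
      placeEmb v (IntermediateField.val L) y = a := by
  refine ⟨compositumEquivEmb v (IntermediateField.val L) ⟨a, mem_compositum_of_mem_localLayer v L ha⟩, ?_, ?_⟩
  · change placeEmb v (IntermediateField.val L) _ = a
    rw [placeEmb_apply, AlgEquiv.symm_apply_apply]
  · intro y hy
    change placeEmb v (IntermediateField.val L) y = a at hy
    apply (compositumEquivEmb v (IntermediateField.val L)).symm.injective
    rw [AlgEquiv.symm_apply_apply]
    exact Subtype.ext ((placeEmb_apply v (IntermediateField.val L) y).symm.trans hy)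

/-- Conversely the image of `placeEmb` lies in the local layer. [cite: CasselsFrohlichANT1967, Ch. II §10] -/
theorem placeEmb_mem_localLayer (y : ((embPlace v (IntermediateField.val L) : HeightOneSpectrum (𝓞 L)).adicCompletion L)) :
    placeEmb v (IntermediateField.val L) y ∈ localLayer K (v.adicCompletion K) L := by
  rw [localLayer_eq_compositum v L]
  exact placeEmb_mem_compositum v (IntermediateField.val L) y

end HomDual

end Literature.NumberTheory.GaloisRepresentations

end
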